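import Literature.Computation.Certificates.SemidefiniteRigorousBounds
import HarnessLib

/-!
# Block-diagonal plumbing for multi-block certificate replays (gauge-boot, task L4 support)

HONEST FRAMING (cell `pub-gaugeboot`): certified bounds on lattice expectations at stated coupling,
gauge group, dimension and torus size; NOT a mass gap, NOT a continuum limit; NOT
Yang–Mills-summit-bearing. This module is elementary linear algebra used by the cell-side certificate
emitter (`HOME/code/gaugeboot/lean-emit/gb_lean_emit.py`, FANOUT-PLAN A27) when a certsdp problem has
SEVERAL PSD blocks (Gram `H` + reflection blocks `R_site`, `R_link`, …): the blocks are assembled into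
ONE block-diagonal matrix over a `Sum` index type, so that the tree soundness theorem
`Literature.Computation.Certificates.JanssonChaykinKeil.lmiForm_bound` is applied with a single block
while the user still supplies positivity block by block.

* `trace_fromBlocks'` — `tr [[A, B], [C, D]] = tr A + tr D`;
* `fromBlocks_diag_mul_diag` — `diag(A, D) · diag(A', D') = diag(A A', D D')`;
* `trace_fromBlocks_diag_mul_diag` — `tr (diag(A, D) · diag(A', D')) = tr (A A') + tr (D D')`;
* `sum_smul_fromBlocks_diag` — `Σ_v y_v • diag(F_v, G_v) = diag(Σ_v y_v • F_v, Σ_v y_v • G_v)`;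
* `posSemidef_fromBlocks_diag` — `A ⪰ 0 → D ⪰ 0 → diag(A, D) ⪰ 0` (real matrices).

All `[folklore]`; nothing here is specific to lattice gauge theory.
-/

namespace Summit.QuantumFields.GaugeBoot.Certificates.Support

open Matrix

variable {m n : Type*} [Fintype m] [Fintype n]

/-- `tr [[A, B], [C, D]] = tr A + tr D`. [folklore] -/
theorem trace_fromBlocks' {R : Type*} [AddCommMonoid R] (A : Matrix m m R) (B : Matrix m n R)
    (C : Matrix n m R) (D : Matrix n n R) :
    trace (fromBlocks A B C D) = trace A + trace D := by
  simp [Matrix.trace, Fintype.sum_sum_type]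

/-- Product of block-diagonal matrices. [folklore] -/
theorem fromBlocks_diag_mul_diag {R : Type*} [NonUnitalNonAssocSemiring R] (A A' : Matrix m m R)
    (D D' : Matrix n n R) :
    fromBlocks A 0 0 D * fromBlocks A' 0 0 D' = fromBlocks (A * A') 0 0 (D * D') := by
  rw [fromBlocks_multiply]
  simp

/-- Trace of a product of block-diagonal matrices. [folklore] -/
theorem trace_fromBlocks_diag_mul_diag {R : Type*} [NonUnitalNonAssocSemiring R]
    (A A' : Matrix m m R) (D D' : Matrix n n R) :
    trace (fromBlocks A 0 0 D * fromBlocks A' 0 0 D') = trace (A * A') + trace (D * D') := by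
  rw [fromBlocks_diag_mul_diag, trace_fromBlocks']

omit [Fintype m] [Fintype n] in
/-- A linear combination of block-diagonal matrices is block-diagonal. [folklore] -/
theorem sum_smul_fromBlocks_diag {R : Type*} [CommRing R] {V : Type*} [Fintype V] (y : V → R)
    (F : V → Matrix m m R) (G : V → Matrix n n R) :
    ∑ v, y v • fromBlocks (F v) 0 0 (G v) = fromBlocks (∑ v, y v • F v) 0 0 (∑ v, y v • G v) := by
  ext i j
  rcases i with i | i <;> rcases j with j | j <;> simp [Matrix.sum_apply]

omit [Fintype m] [Fintype n] in
/-- Casting a block-diagonal integer matrix to `ℝ` blockwise. [folklore] -/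
theorem fromBlocks_diag_map_intCast (A : Matrix m m ℤ) (D : Matrix n n ℤ) :
    (fromBlocks A 0 0 D).map (Int.cast : ℤ → ℝ) =
      fromBlocks (A.map (Int.cast : ℤ → ℝ)) 0 0 (D.map (Int.cast : ℤ → ℝ)) := by
  rw [fromBlocks_map]
  simp [Matrix.map_zero]

/-- **Block-diagonal matrices with PSD blocks are PSD** (real case). [folklore] -/
theorem posSemidef_fromBlocks_diag {A : Matrix m m ℝ} {D : Matrix n n ℝ} (hA : A.PosSemidef)
    (hD : D.PosSemidef) : (fromBlocks A 0 0 D).PosSemidef := by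
  refine PosSemidef.of_dotProduct_mulVec_nonneg (hA.1.fromBlocks (by simp) hD.1) fun x => ?_
  rw [fromBlocks_mulVec, ← Sum.elim_comp_inl_inr (star x), sumElim_dotProduct_sumElim]
  simp only [zero_mulVec, add_zero, zero_add]
  exact add_nonneg (hA.dotProduct_mulVec_nonneg (x ∘ Sum.inl))
    (hD.dotProduct_mulVec_nonneg (x ∘ Sum.inr))

end Summit.QuantumFields.GaugeBoot.Certificates.Support
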